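import Mathlib
import Summits.Ventures.PercRepro2.GradedHall
import Summits.Ventures.PercRepro2.LevelHarrisClosure

/-! # The universal level-conditioned Hall statement (UH*) and its parallel closure
(seat mine-b, cell pub-perc-repro2; MINE-B.md §18.1(a), §21.8)

On a labelled poset `(X, ≤, r, b)` the **universal subset Hall statement** `Universal r b` of MINE-B.md
§18.1(a) is a single injective assignment for ALL levels at once: every source `x` (`r x = 0`, `b x ≥ 1`)
owns `b x` private targets `y ≤ x` with `r y = 1` and `b y ≥ b x − 1`.  It is strictly stronger than the
graded family `{G_k}` (§21.6) and is census-true on every pattern to `n = 5` and on series–parallel cubes.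

Here: (1) `Universal` is closed under PARALLEL composition (sum labels) with no hypothesis at all, by the
coordinate assignments — a slot `i < b x` of the product source `(x, y)` goes to `(f x i, y)`, a slot
`b x + j` to `(x, g y j)`; the two kinds of targets have different red patterns (`(1, 0)` vs `(0, 1)`),
and within a kind the parts' assignments are injective (`universal_par`).  (2) The SERIES composition
with a single free edge (labels `(min (r x) 1, 0)` on the red state, `(0, min (b x) 1)` on the blue one)
satisfies `Universal` given the level-1 Harris inequality of `X` (`universal_ser_edge`): the only sources
are the blue states `(x, blue)` with `b x ≥ 1`, of demand `1`, and Hall on the level-1 Harris inequality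
gives every `x` with `b x ≥ 1` a private `x' ≤ x` with `r x' ≥ 1`, so `(x', red)` is its target.
The general series step — the one open piece of §18.1(a) on series–parallel networks — is not here. -/

namespace Summit.Ventures.PercRepro2.UHClosure

open Finset

variable {X : Type*} [Preorder X]

/-- the sources of (UH*): red level 0 and blue level ≥ 1 -/
abbrev USrc (r b : X → ℕ) : X → Prop := fun x => r x = 0 ∧ 1 ≤ b x

/-- **(UH*)**: an injective assignment of the slots `(x, i < b x)` of the sources to targets `y ≤ x` with
`r y = 1` and `b y + 1 ≥ b x` -/
def Universal [Fintype X] (r b : X → ℕ) : Prop :=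
  ∃ f : SlotL (USrc r b) b → X, Function.Injective f ∧
    ∀ p : SlotL (USrc r b) b, f p ≤ p.1.1.1 ∧ r (f p) = 1 ∧ b p.1.1.1 ≤ b (f p) + 1

variable {Y : Type*} [Preorder Y] [Fintype X] [Fintype Y]

/-- the red label of the parallel product -/
abbrev parR (r : X → ℕ) (r' : Y → ℕ) : X × Y → ℕ := fun p => r p.1 + r' p.2
/-- the blue label of the parallel product -/
abbrev parB (b : X → ℕ) (b' : Y → ℕ) : X × Y → ℕ := fun p => b p.1 + b' p.2

section construction

variable (r b : X → ℕ) (r' b' : Y → ℕ)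

omit [Preorder X] [Preorder Y] [Fintype X] [Fintype Y] in
/-- a source of the product has both red labels `0` -/
lemma src_fst {p : X × Y} (h : USrc (parR r r') (parB b b') p) : r p.1 = 0 := by
  have := h.1; simp only [parR] at this; omega
omit [Preorder X] [Preorder Y] [Fintype X] [Fintype Y] in
/-- a source of the product has both red labels `0` -/
lemma src_snd {p : X × Y} (h : USrc (parR r r') (parB b b') p) : r' p.2 = 0 := by
  have := h.1; simp only [parR] at this; omega

/-- the `X`-slot of a product slot whose index is below `b x` -/
def slotX (q : SlotL (USrc (parR r r') (parB b b')) (parB b b')) (hi : q.1.2.val < b q.1.1.1.1) :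
    SlotL (USrc r b) b :=
  ⟨⟨⟨q.1.1.1.1, ⟨src_fst r b r' b' q.1.1.2.1, by omega⟩, by omega⟩,
    ⟨q.1.2.val, lt_of_lt_of_le hi (le_of_lt (lt_boundL b _))⟩⟩, hi⟩

/-- the `Y`-slot of a product slot whose index is at least `b x` -/
def slotY (q : SlotL (USrc (parR r r') (parB b b')) (parB b b')) (hi : ¬ q.1.2.val < b q.1.1.1.1) :
    SlotL (USrc r' b') b' :=
  ⟨⟨⟨q.1.1.1.2, ⟨src_snd r b r' b' q.1.1.2.1, by have := q.2; simp only [parB] at this; omega⟩,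
      by have := q.2; simp only [parB] at this; omega⟩,
    ⟨q.1.2.val - b q.1.1.1.1, by have := q.2; have := lt_boundL b' q.1.1.1.2; simp only [parB] at *; omega⟩⟩,
   by have := q.2; simp only [parB] at this; simp only; omega⟩

/-- the product assignment built from assignments `f`, `g` of the parts -/
noncomputable def parAssign (f : SlotL (USrc r b) b → X) (g : SlotL (USrc r' b') b' → Y)
    (q : SlotL (USrc (parR r r') (parB b b')) (parB b b')) : X × Y :=
  if hi : q.1.2.val < b q.1.1.1.1 then (f (slotX r b r' b' q hi), q.1.1.1.2)
  else (q.1.1.1.1, g (slotY r b r' b' q hi))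

omit [Preorder X] [Preorder Y] in
/-- two product slots with the same source and the same index are equal -/
lemma slot_ext {S : X × Y → Prop} [DecidablePred S] {d : X × Y → ℕ} (q q' : SlotL S d)
    (h1 : q.1.1.1 = q'.1.1.1) (h2 : q.1.2.val = q'.1.2.val) : q = q' := by
  apply Subtype.ext; apply Prod.ext
  · exact Subtype.ext h1
  · exact Fin.ext h2

end construction

/-- **(UH*) is closed under parallel composition**, with no hypothesis on the parts. -/
theorem universal_par (r b : X → ℕ) (r' b' : Y → ℕ) (hX : Universal r b) (hY : Universal r' b') :
    Universal (parR r r') (parB b b') := by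
  obtain ⟨f, hf, hfs⟩ := hX
  obtain ⟨g, hg, hgs⟩ := hY
  refine ⟨parAssign r b r' b' f g, ?_, ?_⟩
  · -- injectivity
    intro q q' hqq'
    unfold parAssign at hqq'
    by_cases hi : q.1.2.val < b q.1.1.1.1 <;> by_cases hi' : q'.1.2.val < b q'.1.1.1.1
    · rw [dif_pos hi, dif_pos hi'] at hqq'
      have h1 : f (slotX r b r' b' q hi) = f (slotX r b r' b' q' hi') := (Prod.mk.inj hqq').1
      have h2 : q.1.1.1.2 = q'.1.1.1.2 := (Prod.mk.inj hqq').2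
      have h3 := hf h1
      have hx : q.1.1.1.1 = q'.1.1.1.1 := congrArg (fun s : SlotL (USrc r b) b => s.1.1.1) h3
      have hidx : q.1.2.val = q'.1.2.val := congrArg (fun s : SlotL (USrc r b) b => s.1.2.val) h3
      exact slot_ext q q' (Prod.ext hx h2) hidx
    · rw [dif_pos hi, dif_neg hi'] at hqq'
      exfalso
      have h1 : f (slotX r b r' b' q hi) = q'.1.1.1.1 := (Prod.mk.inj hqq').1
      have hr1 := (hfs (slotX r b r' b' q hi)).2.1
      have hr0 := src_fst r b r' b' q'.1.1.2.1
      rw [h1] at hr1; omega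
    · rw [dif_neg hi, dif_pos hi'] at hqq'
      exfalso
      have h1 : q.1.1.1.1 = f (slotX r b r' b' q' hi') := (Prod.mk.inj hqq').1
      have hr1 := (hfs (slotX r b r' b' q' hi')).2.1
      have hr0 := src_fst r b r' b' q.1.1.2.1
      rw [← h1] at hr1; omega
    · rw [dif_neg hi, dif_neg hi'] at hqq'
      have h1 : q.1.1.1.1 = q'.1.1.1.1 := (Prod.mk.inj hqq').1
      have h2 : g (slotY r b r' b' q hi) = g (slotY r b r' b' q' hi') := (Prod.mk.inj hqq').2
      have h3 := hg h2
      have hy : q.1.1.1.2 = q'.1.1.1.2 := congrArg (fun s : SlotL (USrc r' b') b' => s.1.1.1) h3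
      have hidx : q.1.2.val - b q.1.1.1.1 = q'.1.2.val - b q'.1.1.1.1 :=
        congrArg (fun s : SlotL (USrc r' b') b' => s.1.2.val) h3
      exact slot_ext q q' (Prod.ext h1 hy) (by rw [h1] at hi hidx; omega)
  · -- the targets: below the source, red level 1, blue level ≥ source level − 1
    intro q
    unfold parAssign
    by_cases hi : q.1.2.val < b q.1.1.1.1
    · rw [dif_pos hi]
      obtain ⟨hle, hr, hb⟩ := hfs (slotX r b r' b' q hi)
      refine ⟨Prod.mk_le_mk.2 ⟨hle, le_rfl⟩, ?_, ?_⟩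
      · simp only [parR]; rw [hr, src_snd r b r' b' q.1.1.2.1]
      · have hs : (slotX r b r' b' q hi).1.1.1 = q.1.1.1.1 := rfl
        rw [hs] at hb; simp only [parB]; omega
    · rw [dif_neg hi]
      obtain ⟨hle, hr, hb⟩ := hgs (slotY r b r' b' q hi)
      refine ⟨Prod.mk_le_mk.2 ⟨le_rfl, hle⟩, ?_, ?_⟩
      · simp only [parR]; rw [hr, src_fst r b r' b' q.1.1.2.1]
      · have hs : (slotY r b r' b' q hi).1.1.1 = q.1.1.1.2 := rfl
        rw [hs] at hb; simp only [parB]; omega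


/-! ### Series composition with a single free edge -/

section edge

variable (r b : X → ℕ)

/-- the red label of `X` in series with a free edge (`false` = the edge red, `true` = blue) -/
abbrev serR1 : X × Bool → ℕ := fun p => min (r p.1) (if p.2 then 0 else 1)
/-- the blue label of `X` in series with a free edge -/
abbrev serB1 : X × Bool → ℕ := fun p => min (b p.1) (if p.2 then 1 else 0)

omit [Fintype X] in
/-- the level-1 Harris inequality as a lower-set domination with unit demands -/
theorem lowerDom_of_levelHarris1 (h : LevelHarris r b) :
    LowerDom (fun x => 1 ≤ b x) (fun x => 1 ≤ r x) (fun _ => 1) := by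
  intro D hD
  have := h D hD 1
  have e : ∑ x ∈ D, ((if 1 ≤ r x then (1 : ℤ) else 0) - (if 1 ≤ b x then ((1 : ℕ) : ℤ) else 0))
      = ((D.filter (fun x => 1 ≤ r x)).card : ℤ) - ((D.filter (fun x => 1 ≤ b x)).card : ℤ) := by
    rw [Finset.sum_sub_distrib, Finset.card_filter, Finset.card_filter]; push_cast; rfl
  rw [e]
  have : ((D.filter (fun x => 1 ≤ b x)).card : ℤ) ≤ ((D.filter (fun x => 1 ≤ r x)).card : ℤ) := by
    exact_mod_cast this
  linarith

omit [Preorder X] [Fintype X] in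
/-- a source of the edge-series product is a blue state with `b x ≥ 1` -/
lemma src_edge {p : X × Bool} (h : USrc (serR1 r) (serB1 b) p) : p.2 = true ∧ 1 ≤ b p.1 := by
  obtain ⟨h1, h2⟩ := h
  cases hp : p.2 <;> simp only [serR1, serB1, hp] at h1 h2
  · simp at h2
  · exact ⟨rfl, by simpa using h2⟩

/-- **(UH*) holds for `X` in series with a free edge, given the level-1 Harris inequality of `X`.** -/
theorem universal_ser_edge [DecidableEq X] [DecidableRel (α := X) (· ≤ ·)] (h : LevelHarris r b) :
    Universal (serR1 r) (serB1 b) := by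
  obtain ⟨τ, hτ, hτs⟩ := exists_private_targets_of_lowerDom (fun x => 1 ≤ b x) (fun x => 1 ≤ r x) (fun _ => 1)
    (lowerDom_of_levelHarris1 r b h)
  -- the slot of `x` in the Harris assignment
  let mk : SlotL (USrc (serR1 r) (serB1 b)) (serB1 b) → SlotL (fun x => 1 ≤ b x) (fun _ => 1) := fun q =>
    ⟨⟨⟨q.1.1.1.1, (src_edge r b q.1.1.2.1).2, le_rfl⟩, ⟨0, by have := lt_boundL (fun _ => 1) q.1.1.1.1; omega⟩⟩, Nat.one_pos⟩
  refine ⟨fun q => (τ (mk q), false), ?_, ?_⟩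
  · intro q q' hqq'
    have h1 : τ (mk q) = τ (mk q') := (Prod.mk.inj hqq').1
    have h2 := hτ h1
    have hx : q.1.1.1.1 = q'.1.1.1.1 := congrArg (fun s : SlotL (fun x => 1 ≤ b x) (fun _ => 1) => s.1.1.1) h2
    have hb2 : q.1.1.1.2 = true := (src_edge r b q.1.1.2.1).1
    have hb2' : q'.1.1.1.2 = true := (src_edge r b q'.1.1.2.1).1
    have hi : q.1.2.val = 0 := by
      have := q.2; simp [serB1, hb2] at this; omega
    have hi' : q'.1.2.val = 0 := by
      have := q'.2; simp [serB1, hb2'] at this; omega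
    apply Subtype.ext; apply Prod.ext
    · exact Subtype.ext (Prod.ext hx (by rw [hb2, hb2']))
    · exact Fin.ext (by rw [hi, hi'])
  · intro q
    obtain ⟨hle, hr⟩ := hτs (mk q)
    have hb2 : q.1.1.1.2 = true := (src_edge r b q.1.1.2.1).1
    refine ⟨Prod.mk_le_mk.2 ⟨hle, by rw [hb2]; exact Bool.false_le _⟩, ?_, ?_⟩
    · simp only [serR1, Bool.false_eq_true, if_false]; omega
    · simp only [serB1, hb2, Bool.false_eq_true, if_true, if_false]; omega

end edge

end Summit.Ventures.PercRepro2.UHClosure
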